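import Summits.HodgeConjecture.HodgeConjecture.Theorems.R90S4TwistedWeylJacobianAlgebra   -- ★ (TJ1) (this seat): `tau_*`, `S_*`, `L_eq_tau_comp`, `tau_N`, `tau_N_inv`, `b_mul_N`, stability lemmas; brings ★ WEIGHT-DOCK 1∕2, ★ C6, ★ C7, ★ `CartanDecompositionAd`
import HarnessLib

/-!
# R90-TF · S4 (Ch. 13.1–2) · road (J̃♭) «TWISTED TUBE JACOBIAN», FILE (TJ3): THE TWISTED WEIGHT DOCK — `χ(L_ε)² = ‖det_K Φ_reg(N)‖_K`, hence
# `χ(L_ε) = √‖−disc χ_N ∕ det N²‖_K` (`= D_G(N δ)²`, Rogawski 1990 §12.5 p. 186; Labesse 1999 §III.1; Harish-Chandra 1970 Lemma 22)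

Dealt by the S4 dealer (K2E2-plan (g7), 01:54:29Z); census `R90/R90-C131-p04/g2/CENSUS-Jtilde.md` §2–§3 (TJ3).  Crux H413 `stmt-HodgeConjecture-24833`, lane
`--supports … --as helper` (count-neutral).  THEOREMS ONLY — no `def`, no instance, no notation, no named-fact hypothesis, no `sorry`; ★-only imports.  The ε-twin of
★ WEIGHT-DOCK 1∕2 `F0P3cStCharTSJacCartanWeight.addEquivAddHaarChar_sq_eq_normAbs_det` (plain conjugation: `χ(L)² = ‖det Φ_reg‖` through `M_n(K) = 𝔲 ⊕ θ𝔲`).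

SETTING.  `K` a non-archimedean local field of characteristic `0`, `σ : K →+* K` a continuous involution with a skew element `θ ≠ 0` (`σ θ = −θ`), `J` hermitian
invertible, `τ X = J⁻¹ (X.map σ)ᵀ J`, `b ∈ GL_n(K)` with `b ε(b) = ε(b) b` (`ε b = τ(↑b⁻¹)`), `N = b ε(b) ∈ GL_n(K)` with SEPARABLE characteristic polynomial (`δ = b`
ε-regular).  `V = M_n(K) = 𝔷(N) ⊕ 𝔪`, `𝔪 = (Ad N − 1)V` (★ `isCompl_ker_range_adSubOne`).  THE TWISTED LINEAR PART is any `L : V ≃ₜ+ V` with the two laws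
`L = id` on `𝔷(N)` and `L X = b⁻¹ X b + τ X` on `𝔪` (what the chart engine (TJ2) delivers, census §2); `Φ_reg` is any `K`-linear regularised operator at `N` in the
letters of ★ C7 (`Φ ∘ (Ad N − 1) = (Ad N⁻¹ − 1) ∘ (Ad N − 1)`, `Φ = id` on `𝔷(N)`).
HEAD **`addEquivAddHaarChar_sq_eq_normAbs_det_twisted`**: `(addEquivAddHaarChar L)² = ‖det_K Φ_reg‖_K` (any `n`); for `n = 3`, with §1 `exists_adRegularised` and ★ C7,
**`addEquivAddHaarChar_eq_sqrt_normAbs_twisted`**: `addEquivAddHaarChar L = √‖−disc χ_N ∕ det N²‖_K` — the radicand of ★ `cartanWeight_of_ne` at `t = N(δ)` read at the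
place `w`, i.e. print's `D_G(N(δ))²`.
PROOF (no `F`-form, no semilinear determinant).  With the honest additive automorphisms of `V`: `T = τ` (involution), `P = θ •`, `Neg = −1`, put `G₊ := T ∘ L`,
`G₋ := P ∘ G₊ ∘ P⁻¹`, `C := Neg ∘ G₋ ∘ G₊`.  By (TJ1): on `𝔪`, `G₊ = 1 + S`, `G₋ = 1 − S` (`S(θX) = −θ SX`), so `G₋ G₊ = 1 − S² = 1 − Ad(N⁻¹)`; on `𝔷`, `G₊ = τ`,
`G₋ = −τ`, so `G₋ G₊ = −1`.  Hence `C = Φ_reg` POINTWISE (`V = 𝔷 ⊕ 𝔪`), `C` is `K`-linear, and `χ(C) = ‖det Φ_reg‖` (★ C6 + ★ `distribHaarChar_eq_normAbs`), while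
`χ(C) = χ(Neg) χ(G₋) χ(G₊) = 1 · χ(G₊) · χ(G₊)` (`χ(G₋) = χ(G₊)` by ★ C6 `addEquivAddHaarChar_eq_of_semiconj` along `P`; `χ(Neg) = χ(T) = 1`, involutions) and
`χ(G₊) = χ(T) χ(L) = χ(L)`.

HONEST LABEL: HC_CM is proved only modulo the 7 printed citations (2 remaining named inputs: hLiu418 = stmt-HodgeConjecture-24832, h413 = stmt-HodgeConjecture-24833)
until rung 0 closes.  Measure theory ∕ linear algebra toward the OPEN (J̃♭) input of (B1) (it identifies the weight; the tube engine (TJ2)∕(TJ4)∕(TJ5) is separate); pays no socket.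

## References
* [Rogawski1990] J. Rogawski, *Automorphic Representations of Unitary Groups in Three Variables*, Ann. of Math. Stud. 123 (1990), §12.5 p. 186; §4.9 p. 54.
* [Labesse1999] J.-P. Labesse, *Cohomologie, stabilisation et changement de base*, Astérisque 257 (1999), §III.1 (twisted Jacobian `|det(1 − Ad(δ)θ)|`).
* [HarishChandra1970] Harish-Chandra, *Harmonic analysis on reductive p-adic groups*, LNM 162 (1970), Lemma 22.
* [WeilBNT1967] A. Weil, *Basic Number Theory* (1967), Ch. I §2 (`mod_V(L) = mod_K(det L)`).
-/

set_option autoImplicit false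
-- the mandated namespace repeats the single-problem summit's segment (`HodgeConjecture.HodgeConjecture`)
set_option linter.dupNamespace false

noncomputable section

open MeasureTheory MeasureTheory.Measure Set TopologicalSpace Matrix Polynomial
open scoped ENNReal NNReal MatrixGroups
open Literature.MeasureTheory.Group Literature.NumberTheory.GaloisRepresentations.IsNonarchimedeanLocalField
open Summit.HodgeConjecture.HodgeConjecture.Cruxes.H413
open Summit.HodgeConjecture.HodgeConjecture.Cruxes.H413.F0P3cStCharTSCartanDecompositionAd
open Summit.HodgeConjecture.HodgeConjecture.Cruxes.H413.F0P3cStCharTSJacCartanWeight (map_smul_eq tau_add tau_sub tau_smul tau_tau continuous_map_matrix)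
open Summit.HodgeConjecture.HodgeConjecture.Cruxes.H413.F0P3cStCharTSJacCartanModelFrame (continuous_linearMap_matrix)

namespace Summit.HodgeConjecture.HodgeConjecture.R90.S4

/-! ## §1 A regularised operator at `N` exists (projections of `V = 𝔷(N) ⊕ 𝔪`) -/

section Regularised

variable {K : Type*} [Field K] [PerfectField K] {n : Type*} [Fintype n] [DecidableEq n]

/-- **A `K`-linear regularised operator at `N` exists** (`χ_N` separable): `Φ ∘ (Ad N − 1) = (Ad N⁻¹ − 1) ∘ (Ad N − 1)` and `Φ = id` on `𝔷(N)` — namely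
`Φ = π_𝔷 + (Ad N⁻¹ − 1) ∘ π_𝔪` for the projections of `V = 𝔷(N) ⊕ 𝔪` (★ `isCompl_ker_range_adSubOne`, Mathlib `Submodule.linearProjOfIsCompl`); the letters are those of
★ C7 `det_eq_neg_discr_div_det_sq`. [cite: HarishChandra1970, Lemma 22] -/
theorem exists_adRegularised (N : GL n K) (hsep : (N : Matrix n n K).charpoly.Separable) :
    ∃ Φ : Matrix n n K →ₗ[K] Matrix n n K,
      Φ ∘ₗ (LinearMap.mulLeftRight K ((N : Matrix n n K), ((N⁻¹ : GL n K) : Matrix n n K)) - LinearMap.id) =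
        (LinearMap.mulLeftRight K (((N⁻¹ : GL n K) : Matrix n n K), (N : Matrix n n K)) - LinearMap.id) ∘ₗ
          (LinearMap.mulLeftRight K ((N : Matrix n n K), ((N⁻¹ : GL n K) : Matrix n n K)) - LinearMap.id) ∧
      ∀ Z : Matrix n n K, Z * (N : Matrix n n K) = (N : Matrix n n K) * Z → Φ Z = Z := by
  set A : Matrix n n K →ₗ[K] Matrix n n K := LinearMap.mulLeftRight K ((N : Matrix n n K), ((N⁻¹ : GL n K) : Matrix n n K)) - LinearMap.id with hA
  set B : Matrix n n K →ₗ[K] Matrix n n K := LinearMap.mulLeftRight K (((N⁻¹ : GL n K) : Matrix n n K), (N : Matrix n n K)) - LinearMap.id with hB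
  have hc : IsCompl (LinearMap.ker A) (LinearMap.range A) := isCompl_ker_range_adSubOne N hsep
  let πz : Matrix n n K →ₗ[K] Matrix n n K := (LinearMap.ker A).projection (LinearMap.range A) hc
  let πm : Matrix n n K →ₗ[K] Matrix n n K := (LinearMap.range A).projection (LinearMap.ker A) hc.symm
  refine ⟨πz + B ∘ₗ πm, ?_, ?_⟩
  · apply LinearMap.ext
    intro Y
    have hAY : A Y ∈ LinearMap.range A := LinearMap.mem_range_self A Y
    have h1 : πz (A Y) = 0 := (Submodule.projection_apply_eq_zero_iff hc).2 hAY
    have h2 : πm (A Y) = A Y := Submodule.projection_apply_of_mem_left hc.symm hAY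
    simp only [LinearMap.comp_apply, LinearMap.add_apply, h1, h2, zero_add]
  · intro Z hZ
    have hZk : Z ∈ LinearMap.ker A := (mem_ker_adSubOne_iff N Z).2 hZ
    have h1 : πz Z = Z := Submodule.projection_apply_of_mem_left hc hZk
    have h2 : πm Z = 0 := (Submodule.projection_apply_eq_zero_iff hc.symm).2 hZk
    simp only [LinearMap.comp_apply, LinearMap.add_apply, h1, h2, map_zero, add_zero]

end Regularised

/-! ## §2 The twisted weight dock -/

section Main

variable {K : Type*} [Field K] [ValuativeRel K] [TopologicalSpace K] [IsNonarchimedeanLocalField K] [CharZero K] [SecondCountableTopology K]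
  {n : Type*} [Fintype n] [DecidableEq n]

/-- **`χ(L_ε)² = ‖det_K Φ_reg(N)‖_K`** — THE TWISTED WEIGHT DOCK (any `n`).  `σ` a continuous involution of `K` with `σ θ = −θ ≠ 0`, `J` hermitian invertible,
`b ∈ GL_n(K)` commuting with `ε(b) = J⁻¹ ((b⁻¹).map σ)ᵀ J`, `N = b ε(b) ∈ GL_n(K)` with separable characteristic polynomial; `L : M_n(K) ≃ₜ+ M_n(K)` the identity on
`𝔷(N)` and `X ↦ b⁻¹ X b + τ X` on `(Ad N − 1)M_n(K)`; `Φ` any `K`-linear regularised operator at `N`.  Then `(addEquivAddHaarChar L)² = ‖det_K Φ‖_K`.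
Proof: `C := Neg ∘ (P ∘ (τ ∘ L) ∘ P⁻¹) ∘ (τ ∘ L)` (`P = θ •`) equals `Φ` pointwise by ★ (TJ1) (`(1 − S)(1 + S) = 1 − Ad N⁻¹` on `𝔪`, `(−τ) ∘ τ = −1` on `𝔷`), and
`χ(C) = χ(L)²` (★ C6: involutions have `χ = 1`, conjugation by `P` preserves `χ`), `χ(C) = ‖det Φ‖` (★ C6 + ★ `distribHaarChar_eq_normAbs`).
[cite: Labesse1999, §III.1] [cite: HarishChandra1970, Lemma 22] [cite: WeilBNT1967, Ch. I §2] -/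
theorem addEquivAddHaarChar_sq_eq_normAbs_det_twisted (σ : K →+* K) (hσc : Continuous σ) (hσ2 : ∀ a, σ (σ a) = a)
    {θ : K} (hθ0 : θ ≠ 0) (hθσ : σ θ = -θ)
    (J : Matrix n n K) (hJ : IsUnit J.det) (hJh : (J.map σ)ᵀ = J)
    (b N : GL n K) (hN : (N : Matrix n n K) = (b : Matrix n n K) * (J⁻¹ * (((b⁻¹ : GL n K) : Matrix n n K).map σ)ᵀ * J))
    (hcomm : (b : Matrix n n K) * (J⁻¹ * (((b⁻¹ : GL n K) : Matrix n n K).map σ)ᵀ * J) =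
      (J⁻¹ * (((b⁻¹ : GL n K) : Matrix n n K).map σ)ᵀ * J) * (b : Matrix n n K))
    (hsep : (N : Matrix n n K).charpoly.Separable)
    [MeasurableSpace (Matrix n n K)] [BorelSpace (Matrix n n K)] [LocallyCompactSpace (Matrix n n K)]
    (L : Matrix n n K ≃ₜ+ Matrix n n K)
    (hLz : ∀ X : Matrix n n K, X * (N : Matrix n n K) = (N : Matrix n n K) * X → L X = X)
    (hLm : ∀ X Y : Matrix n n K, X = (N : Matrix n n K) * Y * ((N⁻¹ : GL n K) : Matrix n n K) - Y →
      L X = ((b⁻¹ : GL n K) : Matrix n n K) * X * (b : Matrix n n K) + J⁻¹ * (X.map σ)ᵀ * J)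
    (Φ : Matrix n n K →ₗ[K] Matrix n n K)
    (h1 : Φ ∘ₗ (LinearMap.mulLeftRight K ((N : Matrix n n K), ((N⁻¹ : GL n K) : Matrix n n K)) - LinearMap.id) =
      (LinearMap.mulLeftRight K (((N⁻¹ : GL n K) : Matrix n n K), (N : Matrix n n K)) - LinearMap.id) ∘ₗ
        (LinearMap.mulLeftRight K ((N : Matrix n n K), ((N⁻¹ : GL n K) : Matrix n n K)) - LinearMap.id))
    (h2 : ∀ Z : Matrix n n K, Z * (N : Matrix n n K) = (N : Matrix n n K) * Z → Φ Z = Z) :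
    (addEquivAddHaarChar L) ^ 2 = normAbs K (LinearMap.det Φ) := by
  classical
  -- §a algebraic facts about `N`
  have hNinv : ((N⁻¹ : GL n K) : Matrix n n K) = (J⁻¹ * ((b : Matrix n n K).map σ)ᵀ * J) * ((b⁻¹ : GL n K) : Matrix n n K) := by
    rw [Matrix.coe_units_inv, hN]
    exact Matrix.inv_eq_right_inv (N_mul_N_inv (σ := σ) (J := J) hJ b)
  have hNu : IsUnit (N : Matrix n n K).det := (Matrix.isUnit_iff_isUnit_det _).1 (Units.isUnit N)
  have hτN : J⁻¹ * ((N : Matrix n n K).map σ)ᵀ * J = ((N⁻¹ : GL n K) : Matrix n n K) := by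
    rw [hN, hNinv]; exact tau_N hJ hJh hσ2 b hcomm
  have hτN' : J⁻¹ * ((N : Matrix n n K).map σ)ᵀ * J = (N : Matrix n n K)⁻¹ := by rw [hτN, Matrix.coe_units_inv]
  have hτNinv : J⁻¹ * (((N⁻¹ : GL n K) : Matrix n n K).map σ)ᵀ * J = (N : Matrix n n K) := by
    rw [hNinv, hN]; exact tau_N_inv hJ hJh hσ2 b hcomm
  have hτNinv' : J⁻¹ * (((N : Matrix n n K)⁻¹).map σ)ᵀ * J = (N : Matrix n n K) := by rw [← Matrix.coe_units_inv, hτNinv]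
  have hbN : (b : Matrix n n K) * (N : Matrix n n K) = (N : Matrix n n K) * (b : Matrix n n K) := by
    rw [hN]; exact b_mul_N b hcomm
  have hσθinv : σ θ⁻¹ = -θ⁻¹ := by rw [map_inv₀, hθσ, inv_neg]
  -- §b the three honest automorphisms `T = τ`, `P = θ •`, `Neg = −1` of `V = M_n(K)`
  let T : Matrix n n K ≃ₜ+ Matrix n n K :=
    { toFun := fun X => J⁻¹ * (X.map σ)ᵀ * J
      invFun := fun X => J⁻¹ * (X.map σ)ᵀ * J
      left_inv := fun X => tau_tau σ J hJ hJh hσ2 X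
      right_inv := fun X => tau_tau σ J hJ hJh hσ2 X
      map_add' := fun X Y => tau_add σ J X Y
      continuous_toFun := (continuous_const.mul (continuous_map_matrix σ hσc).matrix_transpose).mul continuous_const
      continuous_invFun := (continuous_const.mul (continuous_map_matrix σ hσc).matrix_transpose).mul continuous_const }
  have hT : ∀ X, T X = J⁻¹ * (X.map σ)ᵀ * J := fun X => rfl
  let P : Matrix n n K ≃ₜ+ Matrix n n K :=
    { toFun := fun X => θ • X
      invFun := fun X => θ⁻¹ • X
      left_inv := fun X => by simp only [smul_smul, inv_mul_cancel₀ hθ0, one_smul]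
      right_inv := fun X => by simp only [smul_smul, mul_inv_cancel₀ hθ0, one_smul]
      map_add' := fun X Y => smul_add θ X Y
      continuous_toFun := continuous_const_smul θ
      continuous_invFun := continuous_const_smul θ⁻¹ }
  have hP : ∀ X, P X = θ • X := fun X => rfl
  have hPs : ∀ X, P.symm X = θ⁻¹ • X := fun X => rfl
  let Ng : Matrix n n K ≃ₜ+ Matrix n n K :=
    { toFun := fun X => -X
      invFun := fun X => -X
      left_inv := fun X => neg_neg X
      right_inv := fun X => neg_neg X
      map_add' := fun X Y => neg_add X Y
      continuous_toFun := continuous_neg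
      continuous_invFun := continuous_neg }
  have hNg : ∀ X, Ng X = -X := fun X => rfl
  -- §c the composite `C = Neg ∘ G₋ ∘ G₊`
  let Gp : Matrix n n K ≃ₜ+ Matrix n n K := L.trans T
  have hGp : ∀ X, Gp X = J⁻¹ * ((L X).map σ)ᵀ * J := fun X => rfl
  let Gm : Matrix n n K ≃ₜ+ Matrix n n K := (P.symm.trans Gp).trans P
  have hGm : ∀ X, Gm X = θ • Gp (θ⁻¹ • X) := fun X => rfl
  let C : Matrix n n K ≃ₜ+ Matrix n n K := (Gp.trans Gm).trans Ng
  have hC : ∀ X, C X = -(Gm (Gp X)) := fun X => rfl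
  -- §d `C = Φ` on `𝔷(N)`
  have hCz : ∀ u : Matrix n n K, u * (N : Matrix n n K) = (N : Matrix n n K) * u → C u = Φ u := by
    intro u hu
    have hτu : (J⁻¹ * (u.map σ)ᵀ * J) * (N : Matrix n n K) = (N : Matrix n n K) * (J⁻¹ * (u.map σ)ᵀ * J) :=
      tau_mem_commutant hJ hNu hτN' hu
    have hθτu : (θ⁻¹ • (J⁻¹ * (u.map σ)ᵀ * J)) * (N : Matrix n n K) = (N : Matrix n n K) * (θ⁻¹ • (J⁻¹ * (u.map σ)ᵀ * J)) :=
      smul_mem_commutant θ⁻¹ hτu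
    have hGpu : Gp u = J⁻¹ * (u.map σ)ᵀ * J := by rw [hGp, hLz u hu]
    have hGp2 : Gp (θ⁻¹ • (J⁻¹ * (u.map σ)ᵀ * J)) = -(θ⁻¹ • u) := by
      rw [hGp, hLz _ hθτu, map_smul_eq, Matrix.transpose_smul, Matrix.mul_smul, Matrix.smul_mul, tau_tau σ J hJ hJh hσ2 u, hσθinv, neg_smul]
    rw [hC, hGm, hGpu, hGp2, h2 u hu, smul_neg, smul_smul, mul_inv_cancel₀ hθ0, one_smul, neg_neg]
  -- §e `C = Φ` on `𝔪 = (Ad N − 1)V`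
  have hCm : ∀ Y : Matrix n n K,
      C ((N : Matrix n n K) * Y * ((N⁻¹ : GL n K) : Matrix n n K) - Y) = Φ ((N : Matrix n n K) * Y * ((N⁻¹ : GL n K) : Matrix n n K) - Y) := by
    intro Y
    -- abbreviations (as plain terms): `w = N Y N⁻¹ − Y`, `S w = τ(b⁻¹ w b)`
    have hΦw : Φ ((N : Matrix n n K) * Y * ((N⁻¹ : GL n K) : Matrix n n K) - Y) =
        ((N⁻¹ : GL n K) : Matrix n n K) * ((N : Matrix n n K) * Y * ((N⁻¹ : GL n K) : Matrix n n K) - Y) * (N : Matrix n n K) -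
          ((N : Matrix n n K) * Y * ((N⁻¹ : GL n K) : Matrix n n K) - Y) := by
      have h := LinearMap.congr_fun h1 Y
      simp only [LinearMap.comp_apply, LinearMap.sub_apply, LinearMap.mulLeftRight_apply, LinearMap.id_apply] at h
      exact h
    -- `S w` is again in `𝔪`: `S w = N Y₂ N⁻¹ − Y₂`, `Y₂ = τ(b⁻¹ Y b)`
    have hSw : J⁻¹ * ((((b⁻¹ : GL n K) : Matrix n n K) * ((N : Matrix n n K) * Y * ((N⁻¹ : GL n K) : Matrix n n K) - Y) * (b : Matrix n n K)).map σ)ᵀ * J =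
        (N : Matrix n n K) * (J⁻¹ * ((((b⁻¹ : GL n K) : Matrix n n K) * Y * (b : Matrix n n K)).map σ)ᵀ * J) * ((N⁻¹ : GL n K) : Matrix n n K) -
          J⁻¹ * ((((b⁻¹ : GL n K) : Matrix n n K) * Y * (b : Matrix n n K)).map σ)ᵀ * J := by
      rw [show ((N⁻¹ : GL n K) : Matrix n n K) = (N : Matrix n n K)⁻¹ from Matrix.coe_units_inv N, conj_adSubOne b hNu hbN Y,
        tau_adSubOne hJ hτN' hτNinv']
    -- the generic step: for `X = N Y' N⁻¹ − Y'`, `Gp X = S X + X`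
    have hGp_m : ∀ Y' : Matrix n n K,
        Gp ((N : Matrix n n K) * Y' * ((N⁻¹ : GL n K) : Matrix n n K) - Y') =
          J⁻¹ * ((((b⁻¹ : GL n K) : Matrix n n K) * ((N : Matrix n n K) * Y' * ((N⁻¹ : GL n K) : Matrix n n K) - Y') * (b : Matrix n n K)).map σ)ᵀ * J +
            ((N : Matrix n n K) * Y' * ((N⁻¹ : GL n K) : Matrix n n K) - Y') := by
      intro Y'
      rw [hGp, hLm _ Y' rfl, tau_add, tau_tau σ J hJ hJh hσ2]
    set w : Matrix n n K := (N : Matrix n n K) * Y * ((N⁻¹ : GL n K) : Matrix n n K) - Y with hw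
    set Sw : Matrix n n K := J⁻¹ * ((((b⁻¹ : GL n K) : Matrix n n K) * w * (b : Matrix n n K)).map σ)ᵀ * J with hSwdef
    set Y₂ : Matrix n n K := J⁻¹ * ((((b⁻¹ : GL n K) : Matrix n n K) * Y * (b : Matrix n n K)).map σ)ᵀ * J with hY₂
    -- `S w + w ∈ 𝔪` with witness `Y₂ + Y`, and so is `θ⁻¹ • (S w + w)`
    have hsum : Sw + w = (N : Matrix n n K) * (Y₂ + Y) * ((N⁻¹ : GL n K) : Matrix n n K) - (Y₂ + Y) := by
      rw [hSw, hw, Matrix.mul_add, Matrix.add_mul]; abel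
    have hsmul : θ⁻¹ • (Sw + w) = (N : Matrix n n K) * (θ⁻¹ • (Y₂ + Y)) * ((N⁻¹ : GL n K) : Matrix n n K) - θ⁻¹ • (Y₂ + Y) := by
      rw [hsum, smul_sub, Matrix.mul_smul, Matrix.smul_mul]
    -- `S (S w) = N⁻¹ w N` and `S` additive, semilinear
    have hSS : J⁻¹ * ((((b⁻¹ : GL n K) : Matrix n n K) * Sw * (b : Matrix n n K)).map σ)ᵀ * J = ((N⁻¹ : GL n K) : Matrix n n K) * w * (N : Matrix n n K) := by
      rw [hSwdef, S_S σ J hJ hJh hσ2 b w, hNinv, hN]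
    have hS_sum : J⁻¹ * ((((b⁻¹ : GL n K) : Matrix n n K) * (θ⁻¹ • (Sw + w)) * (b : Matrix n n K)).map σ)ᵀ * J =
        -(θ⁻¹ • (((N⁻¹ : GL n K) : Matrix n n K) * w * (N : Matrix n n K) + Sw)) := by
      rw [S_smul σ J b, S_add σ J b, hSS, hσθinv, neg_smul]
    -- assemble
    have hGpw : Gp w = Sw + w := by rw [hw, hGp_m Y]
    have hGp2 : Gp (θ⁻¹ • (Sw + w)) = -(θ⁻¹ • (((N⁻¹ : GL n K) : Matrix n n K) * w * (N : Matrix n n K) + Sw)) + θ⁻¹ • (Sw + w) := by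
      rw [hsmul, hGp_m, ← hsmul, hS_sum]
    rw [hC, hGm, hGpw, hGp2, hΦw, smul_add, smul_neg, smul_smul, mul_inv_cancel₀ hθ0, one_smul, smul_smul, mul_inv_cancel₀ hθ0, one_smul]
    abel
  -- §f `C = Φ` everywhere (`V = 𝔷 ⊕ 𝔪`)
  have hc : IsCompl
      (LinearMap.ker (LinearMap.mulLeftRight K ((N : Matrix n n K), ((N⁻¹ : GL n K) : Matrix n n K)) - LinearMap.id : Matrix n n K →ₗ[K] Matrix n n K))
      (LinearMap.range (LinearMap.mulLeftRight K ((N : Matrix n n K), ((N⁻¹ : GL n K) : Matrix n n K)) - LinearMap.id : Matrix n n K →ₗ[K] Matrix n n K)) :=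
    isCompl_ker_range_adSubOne N hsep
  have hCΦ : ∀ Z, C Z = Φ Z := by
    intro Z
    have htop : Z ∈
        LinearMap.ker (LinearMap.mulLeftRight K ((N : Matrix n n K), ((N⁻¹ : GL n K) : Matrix n n K)) - LinearMap.id : Matrix n n K →ₗ[K] Matrix n n K) ⊔
        LinearMap.range (LinearMap.mulLeftRight K ((N : Matrix n n K), ((N⁻¹ : GL n K) : Matrix n n K)) - LinearMap.id : Matrix n n K →ₗ[K] Matrix n n K) := by
      rw [hc.sup_eq_top]; exact Submodule.mem_top
    obtain ⟨u, hu, w, hw, rfl⟩ := Submodule.mem_sup.1 htop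
    have hu' : u * (N : Matrix n n K) = (N : Matrix n n K) * u := (mem_ker_adSubOne_iff N u).1 hu
    obtain ⟨Y, rfl⟩ := (mem_range_adSubOne_iff N w).1 hw
    rw [map_add, map_add, hCz u hu', hCm Y]
  -- §g Haar characters: `χ(C) = χ(L)²`
  haveI : SecondCountableTopology (Matrix n n K) := inferInstanceAs (SecondCountableTopology (n → n → K))
  have hχT : addEquivAddHaarChar T = 1 := addEquivAddHaarChar_eq_one_of_involutive T (fun X => tau_tau σ J hJ hJh hσ2 X)
  have hχNg : addEquivAddHaarChar Ng = 1 := addEquivAddHaarChar_eq_one_of_involutive Ng (fun X => neg_neg X)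
  have hχGp : addEquivAddHaarChar Gp = addEquivAddHaarChar L := by
    rw [show Gp = L.trans T from rfl, addEquivAddHaarChar_trans, hχT, mul_one]
  have hχGm : addEquivAddHaarChar Gp = addEquivAddHaarChar Gm :=
    addEquivAddHaarChar_eq_of_semiconj P Gp Gm (fun X => by
      show P (Gp X) = P (Gp (P.symm (P X)))
      rw [ContinuousAddEquiv.symm_apply_apply])
  have hχC : addEquivAddHaarChar C = addEquivAddHaarChar L ^ 2 := by
    rw [show C = (Gp.trans Gm).trans Ng from rfl, addEquivAddHaarChar_trans, addEquivAddHaarChar_trans, hχNg, mul_one, ← hχGm, hχGp, sq]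
  -- §h `χ(C) = ‖det Φ‖` (`C` is the continuous `K`-linear automorphism `Φ`)
  borelize K
  have hbij : Function.Bijective Φ := by
    rw [show (Φ : Matrix n n K → Matrix n n K) = C from (funext hCΦ).symm]; exact C.bijective
  let ΦK : Matrix n n K ≃L[K] Matrix n n K :=
    { LinearEquiv.ofBijective Φ hbij with
      continuous_toFun := continuous_linearMap_matrix Φ
      continuous_invFun := continuous_linearMap_matrix ((LinearEquiv.ofBijective Φ hbij).symm : Matrix n n K →ₗ[K] Matrix n n K) }
  have hΦK : ΦK.toContinuousAddEquiv = C := by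
    apply ContinuousAddEquiv.ext
    intro Z
    exact (hCΦ Z).symm
  let eM : Matrix n n K ≃L[K] (n × n → K) :=
    { toFun := fun Z p => Z p.1 p.2
      invFun := fun v => Matrix.of fun i j => v (i, j)
      map_add' := fun _ _ => rfl
      map_smul' := fun _ _ => rfl
      left_inv := fun _ => rfl
      right_inv := fun _ => rfl
      continuous_toFun := continuous_pi fun p => (continuous_apply p.2).comp (continuous_apply p.1)
      continuous_invFun := continuous_matrix fun i j => continuous_apply (i, j) }
  have hC6 := addEquivAddHaarChar_continuousLinearEquiv_of_trivialization eM ΦK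
  rw [hΦK, Literature.NumberTheory.Automorphic.UnitaryGroup.distribHaarChar_eq_normAbs, LinearEquiv.coe_det] at hC6
  rw [← hχC, hC6]
  rfl

/-- **THE TWISTED JACOBIAN WEIGHT, `n = 3`: `addEquivAddHaarChar L = √‖−disc χ_N ∕ det N²‖_K`** — same hypotheses without `Φ` (§1 `exists_adRegularised` + ★ C7
`det_eq_neg_discr_div_det_sq`).  At `K = L_w`, `N = N(δ)_w`: the radicand is ★ `cartanWeight_of_ne`'s `∏_w |disc χ_t|_w (∏_w |det t|_w ²)⁻¹` at `t = N(δ)` (one place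
`w ∣ v`), i.e. print's `D_G(N(δ))²`. [cite: Rogawski1990, §12.5 p. 186; §4.9 p. 54] [cite: Labesse1999, §III.1] [cite: HarishChandra1970, Lemma 22] -/
theorem addEquivAddHaarChar_eq_sqrt_normAbs_twisted (σ : K →+* K) (hσc : Continuous σ) (hσ2 : ∀ a, σ (σ a) = a)
    {θ : K} (hθ0 : θ ≠ 0) (hθσ : σ θ = -θ)
    (J : Matrix (Fin 3) (Fin 3) K) (hJ : IsUnit J.det) (hJh : (J.map σ)ᵀ = J)
    (b N : GL (Fin 3) K) (hN : (N : Matrix (Fin 3) (Fin 3) K) = (b : Matrix (Fin 3) (Fin 3) K) * (J⁻¹ * (((b⁻¹ : GL (Fin 3) K) : Matrix (Fin 3) (Fin 3) K).map σ)ᵀ * J))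
    (hcomm : (b : Matrix (Fin 3) (Fin 3) K) * (J⁻¹ * (((b⁻¹ : GL (Fin 3) K) : Matrix (Fin 3) (Fin 3) K).map σ)ᵀ * J) =
      (J⁻¹ * (((b⁻¹ : GL (Fin 3) K) : Matrix (Fin 3) (Fin 3) K).map σ)ᵀ * J) * (b : Matrix (Fin 3) (Fin 3) K))
    (hsep : (N : Matrix (Fin 3) (Fin 3) K).charpoly.Separable)
    [MeasurableSpace (Matrix (Fin 3) (Fin 3) K)] [BorelSpace (Matrix (Fin 3) (Fin 3) K)] [LocallyCompactSpace (Matrix (Fin 3) (Fin 3) K)]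
    (L : Matrix (Fin 3) (Fin 3) K ≃ₜ+ Matrix (Fin 3) (Fin 3) K)
    (hLz : ∀ X : Matrix (Fin 3) (Fin 3) K, X * (N : Matrix (Fin 3) (Fin 3) K) = (N : Matrix (Fin 3) (Fin 3) K) * X → L X = X)
    (hLm : ∀ X Y : Matrix (Fin 3) (Fin 3) K, X = (N : Matrix (Fin 3) (Fin 3) K) * Y * ((N⁻¹ : GL (Fin 3) K) : Matrix (Fin 3) (Fin 3) K) - Y →
      L X = ((b⁻¹ : GL (Fin 3) K) : Matrix (Fin 3) (Fin 3) K) * X * (b : Matrix (Fin 3) (Fin 3) K) + J⁻¹ * (X.map σ)ᵀ * J) :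
    addEquivAddHaarChar L =
      NNReal.sqrt (normAbs K (-((N : Matrix (Fin 3) (Fin 3) K).charpoly.discr) / ((N : Matrix (Fin 3) (Fin 3) K).det) ^ 2)) := by
  obtain ⟨Φ, h1, h2⟩ := exists_adRegularised N hsep
  rw [← NNReal.sqrt_sq (addEquivAddHaarChar L),
    addEquivAddHaarChar_sq_eq_normAbs_det_twisted σ hσc hσ2 hθ0 hθσ J hJ hJh b N hN hcomm hsep L hLz hLm Φ h1 h2,
    F0P3cStCharTSAdRegularisedDescent.det_eq_neg_discr_div_det_sq N hsep Φ h1 h2]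

end Main

end Summit.HodgeConjecture.HodgeConjecture.R90.S4

end
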